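import Summits.BirchSwinnertonDyer.BirchSwinnertonDyer.Theorems.KatoDescentPotSupersingularUnitIndexMuDoorsFukudaAt
import HarnessLib

/-!
# Route `KatoDescentPotSupersingular` (rung K9, cell `bsd-potss`), aside item `WildFineSelmerCoatesSujatha` (19386), registered stub
# `stub_fineA_wild_surjModThree` (the `GL₂(𝔽₃)`-image / 9-deficient rows): statement (A) at `(388800ij1, 3)` with the classical `μ`-hypothesis
# DISCHARGED modulo Fukuda 1994 Thm. 1 (1) at layers `(1,2)` of the cyclotomic `ℤ_3`-tower of `L_P = ℚ(E[3])^{U_P}` — twin of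
# `…WildConjAResidueUnitIndexRows06` (`388800ho1`), which has the SAME field `L_P` and the same three octic leaves (conjA-anchor g14 INBOX
# 2026-08-28T15:33Z (3)); seat `bsd-potss-k9-c4` g21 (turnkey draft of g20); `--supports stmt-BirchSwinnertonDyer-19386 --as helper`

HONEST FRAMING. THEOREM ONLY (no definition, no named fact, no `sorry`); PER ROW; nothing booked; item 19386 stays OPEN; (A), Conjecture A and
BSD proved for NO curve.  (`388800ij1` is outside 19942's residue — it already carries unit-twist U₀ records `missingUpperBoundAt_g388800ij1_3_nf/_tam`
— so only the (A) statement is filed here; with it every one of the 20 `GL₂(𝔽₃)` rows of the stub is roaded at the evidence tier, conjA-anchor g14.)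
CONDITIONAL on the named facts `hLim` (Lim 2017 Thm. 3.5), `hF1` (Fukuda 1994 Thm. 1 (1)) and on two displayed NUMERIC hypotheses about
`L_P = ℚ(E[3])^{U_P}` (`= ℚ(P, ζ₃) = ℚ[x]/(x¹⁶+24x¹²+112x¹⁰+624x⁸+1344x⁶+1984x⁴+2688x²+2304)`, degree 16 — the same field as for `388800ho1`:
the two curves are the `GL₂(𝔽₃)` rows of conductor `388800` sharing `O_grow`, conjA-anchor g9 / g14):
* `hram` — Fukuda index `0` on `L_P` (its four primes above `3` totally ramified in the first layer; EXACT, k9-c4 g19 kit j308542);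
* `hord` — `e₂(L_P) = e₁(L_P) = 1`.  EVIDENCE exactly as in `…UnitIndexRows06` (module docstring there): Kuroda for the biquadratic `L_P/k`
  (tree theorem `IwasawaTheory.classNumberPExp_biquadratic_relation`) + the PASS:UNIT leaves `k = x⁴−6x²−7x−3`, `O₁ = x⁸+20x⁶−36x⁴+48x²−48`,
  `O₃ = x⁸−x⁷+x⁶−8x⁵+5x⁴−2x³+16x²−4x+1` (`h = 1, 2, 2` CERTIFIED, j308542; `e_n = 0` by `forall_classicalMuVanishes_of_relIndex_mul_eq`) give
  `e_n(L_P) = e_n(O_grow)`, `O_grow = ℚ(P) = x⁸−2x⁷+x⁶+56x⁵−130x⁴+146x³−114x²+48x−15`; door UG at layers `(1,2)` on `O_grow` (conjA-anchor g14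
  kit **j311095**: `F = O_grow,1` degree 24, `h = 6` GRH, `s = 3` totally ramified primes, prime classes span `Cl(F)/Cl(F)³`, unit norm symbol
  rank `2 = s − 1`) gives `e₂(O_grow) = e₁(O_grow) = 1` by the KERNEL theorem `IwasawaTheory.classNumberPExp_succ_eq_of_sup_eq_top`.  GRH
  enters only through `h(O_grow,1) = 6`; cross-check pending: k9-c4 kit j308794 (`h(O_grow,2)`, degree 72).

References: [Lim2017FineSelmer] §3 Thm. 3.5, Lemma 3.2; [Fukuda1994] Thm. 1 (1); [Lang1990] Ch. 13 §4 Lemma 4.1; [Lemmermeyer1994] §1;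
[Serre1972] §IV; [Cremona2006] Table 1.
-/

set_option linter.dupNamespace false
set_option autoImplicit false

noncomputable section

open scoped Classical NumberField
open WeierstrassCurve NumberField IsDedekindDomain Field IntermediateField
  Literature.NumberTheory.EllipticCurves Literature.NumberTheory.EllipticCurves.Rank1Residual
  Literature.NumberTheory.EllipticCurves.Rank1Residual.Typed
  Literature.NumberTheory.GaloisRepresentations Literature.NumberTheory.SerreUniformity Literature.NumberTheory.IwasawaTheory
  Summit.BirchSwinnertonDyer.Rank1Residual Summit.BirchSwinnertonDyer.Rank1Residual.Additive
  Summit.BirchSwinnertonDyer.BirchSwinnertonDyer.Theorems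

namespace Summit.BirchSwinnertonDyer.BirchSwinnertonDyer.Theorems.WildUpperUnitTwistRecords

/-- **(A) AT `(388800ij1, 3)` with the `μ`-hypothesis DISCHARGED by FUKUDA Thm. 1 (1) at layers `(1,2)` on `L_P = ℚ(E[3])^{U_P}`** (modulo `hLim`, `hF1`):
`P` any geometric `3`-torsion point; displayed `hram` (exact, kit j308542) and `hord` (evidence: door UG on `O_grow` at `(1,2)`, kit j311095, GRH through `h(O_grow,1) = 6`,
+ Kuroda + the PASS:UNIT leaves, kit j308542 — module docstring). A row of 19386's stub `stub_fineA_wild_surjModThree`. CONDITIONAL;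
nothing booked; (A)/BSD proved for no curve. [cite: Lim2017FineSelmer, §3 Thm. 3.5 and Lemma 3.2 (arXiv:1306.2047 pp. 6–7)] [cite: Fukuda1994, Thm. 1 (1), p. 264]
[cite: Cremona2006, Table 1 (Cremona label 388800ij1)] -/
theorem conjA_g388800ij1_3_lp12
    (hLim : Lim2017.thm35_fineSelmerDual_moduleFinite_of_classicalMuVanishes_of_le_divisionField)
    (hF1 : fukuda1994_thm1_classNumberPExp_const_of_succ_eq)
    {W : WeierstrassCurve ℚ} [W.IsElliptic] (hWeq : W = (⟨0, 0, 0, (-121500), 16301250⟩ : WeierstrassCurve ℚ)) (P : W.geomTorsion (3 : ℕ))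
    (hram : ∀ κ : ZpExtension ↥(W.unipotentStabilizerField 3 P) 3, κ.IsCyclotomic → TotallyRamifiedFrom κ 0)
    (hord : ∀ κ : ZpExtension ↥(W.unipotentStabilizerField 3 P) 3, κ.IsCyclotomic →
      classNumberPExp κ (1 + 1) = classNumberPExp κ 1)
    (κ : ZpExtension ℚ 3) (hκ : κ.IsCyclotomic) :
    ∃ (γ : absoluteGaloisGroup ℚ) (Df : W.FineSelmerDualData κ γ),
      Module.Finite ℤ_[3] (RestrictScalars ℤ_[3] (IwasawaAlgebra 3) Df.X) := by
  subst hWeq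
  haveI : Fact (Nat.Prime 3) := ⟨Nat.prime_three⟩
  exact Lim2017.fineSelmerDual_moduleFinite_of_classNumberPExp_succ_eq_unipotentStabilizerField hF1 hLim _ 3 (by decide) 1 P hram hord κ hκ

end Summit.BirchSwinnertonDyer.BirchSwinnertonDyer.Theorems.WildUpperUnitTwistRecords

end
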